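import Summits.AtomisticToContinuum.FouriersLaw.Theorems.OddSectorIrreversibilityConeScaleCorrectorStubConeTransportBudgetContraction

/-!
# `ConeScaleCorrector` (E1): the Dynkin split `u − u_τ = P_τ u` and `E1 ⟹ PostCrossingForecast` (C2 is necessary)

Support file for crux stmt-AtomisticToContinuum-14069 (`OddSectorIrreversibility.ConeScaleCorrector`, E1). The route
text's exact fixed-`N` reformulation (β) "DYNKIN SPLIT `u = u_τ + P_τ u` … so `u − u_τ` is the forecast of the transport
still to come after `τ`" is the object behind every "post-crossing" leaf of the census (C2 `PostCrossingForecast` of D1,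
FD2, (EC′), D4/D8). This file makes it a theorem for the equilibrium OPEN pinned chain and draws the planning consequence:

* `act_centredCorrector_eq` — for `N ≥ 1`, `τ ≥ 0` and EVERY phase point `x`, the canonical (everywhere-defined) Kubo
  corrector `u⋆ = ∫_{(0,∞)} P_tJ_tot dt` satisfies `(P_τ u⋆)(x) = u⋆(x) − ∫_{(0,τ]} P_tJ_tot(x) dt`
  (Fubini against `P_τ(x,·) ⊗ dt` with the Harris / Lyapunov domination `|P_tJ(y)| ≤ KC e^{ϑH(y)}e^{−ct}`,
  Chapman–Kolmogorov on functions `P_τ(P_tJ) = P_{t+τ}J`, translation `t ↦ t + τ`, and the split `(0,∞) = (0,τ] ∪ (τ,∞)`).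
* `integral_sq_sub_horizonCorrector_le` — hence for EVERY `μ_T`-a.e. limit `u` of the finite-horizon correctors and every
  `τ ≥ 0`: `∫ (u − u_τ)² dμ_T ≤ ∫ u² dμ_T` (`u = u⋆` a.e. by uniqueness of limits; `L²(μ_T)`-contraction of `P_τ` applied
  to the strongly measurable, exponentially dominated `u⋆` — `pinnedChain_integral_sq_act_le_of_stronglyMeasurable`).
* `postCrossingForecast_of_coneScaleCorrector` — **E1 ⟹ C2** (`PostCrossingForecast`, verbatim the second leaf of the landed
  D1 glue `coneScaleCorrector_of_coneTransportBudget_of_postCrossingForecast`, with `a = 1` and E1's own constant):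
  C2 is NECESSARY for E1, so in the census split D1 = C1 ∧ C2 the only risk added beyond E1 itself is C1
  (`ConeTransportBudget`, the open chain's Einstein–Helfand budget at all windows).

No definitions; nothing here closes the crux.
-/

noncomputable section

open MeasureTheory ProbabilityTheory Filter Topology Set
open scoped ENNReal NNReal
open Literature.MathematicalPhysics.KineticTheory.HeatConduction
open Literature.MathematicalPhysics.KineticTheory.OddSectorLocality

namespace Summit.AtomisticToContinuum.FouriersLaw.Theorems.OddSectorIrreversibility

open Summit.AtomisticToContinuum.FouriersLaw.Theorems.SubdiffusiveBondHeat
open Summit.AtomisticToContinuum.FouriersLaw.Theorems.LightConeBondHeat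

variable {N : ℕ} {ω₂ lam β γ T : ℝ}

/-- **The Dynkin split, pointwise.** For `N ≥ 1`, `τ ≥ 0` and every `x`:
`∫ u⋆ dP_τ(x,·) = u⋆(x) − ∫_{(0,τ]} P_tJ_tot(x) dt` for the canonical corrector `u⋆ = ∫_{(0,∞)} P_tJ_tot dt`
(Fubini + Chapman–Kolmogorov + translation invariance of Lebesgue measure). [folklore] -/
theorem act_centredCorrector_eq (hω : 0 < ω₂) (hl : 0 ≤ lam) (hβ : 0 < β) (hγ : 0 < γ) (hN : 0 < N)
    (hT : 0 < T) {τ : ℝ} (hτ : 0 ≤ τ) (x : PhaseSpace N) :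
    ∫ y, (∫ t in Ioi (0 : ℝ), currentForecast ω₂ lam β γ T N t y)
        ∂((pinnedChain ω₂ lam β γ).transitionKernel N T T τ.toNNReal x) =
      (∫ t in Ioi (0 : ℝ), currentForecast ω₂ lam β γ T N t x) -
        ∫ t in Ioc (0 : ℝ) τ, currentForecast ω₂ lam β γ T N t x := by
  -- Harris / Lyapunov constants at `ϑ = 1/(4T)`
  obtain ⟨hϑ0, h2ϑ⟩ := quarter_inv_temp_admissible hT
  have hϑ1 : 1 / (4 * T) < 1 / T := by linarith
  obtain ⟨K, c, hK, hc, hbd⟩ := pinnedChain_harris_bound hω hl hβ hγ hN hT hϑ0 hϑ1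
  have hJc := continuous_totalBondCurrent ω₂ lam β γ N
  have hJb := abs_totalBondCurrent_le_exp hω.le hl hβ.le γ N hϑ0
  have hJ0 := integral_totalBondCurrent_gibbsMeasure hω hl hβ.le γ N hT
  have hC : (0 : ℝ) ≤ N * (N * ((3 + β) / 2) * (2 * Real.exp (1 / (4 * T)) / (1 / (4 * T)) ^ 2)) := by
    have := hβ.le
    positivity
  haveI : IsMarkovKernel ((pinnedChain ω₂ lam β γ).transitionKernel N T T τ.toNNReal) :=
    pinnedChain_isMarkovKernel_transitionKernel hω hl hβ.le hγ.le N T T τ.toNNReal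
  -- Step 1: Fubini against `P_τ(x, ·) ⊗ dt|_{(0,∞)}`
  have hint : Integrable (Function.uncurry fun (y : PhaseSpace N) (t : ℝ) => currentForecast ω₂ lam β γ T N t y)
      (((pinnedChain ω₂ lam β γ).transitionKernel N T T τ.toNNReal x).prod (volume.restrict (Ioi (0 : ℝ)))) := by
    have hmeas : AEStronglyMeasurable
        (Function.uncurry fun (y : PhaseSpace N) (t : ℝ) => currentForecast ω₂ lam β γ T N t y)
        (((pinnedChain ω₂ lam β γ).transitionKernel N T T τ.toNNReal x).prod (volume.restrict (Ioi (0 : ℝ)))) :=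
      ((pinnedChain_stronglyMeasurable_act_uncurry hω hl hβ.le hγ.le T T hJc.measurable).comp_measurable
        measurable_swap).aestronglyMeasurable
    refine Integrable.mono'
      (((pinnedChain_integrable_exp_mul_hamiltonian_transitionKernel hω hl hT hβ.le hγ.le hN hϑ0 hϑ1
        τ.toNNReal x).const_mul (K * (N * (N * ((3 + β) / 2) * (2 * Real.exp (1 / (4 * T)) /
          (1 / (4 * T)) ^ 2))))).mul_prod (exp_neg_integrableOn_Ioi 0 hc)) hmeas
      (Eventually.of_forall fun q => ?_)
    rw [Real.norm_eq_abs]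
    calc _ ≤ _ := centred_abs_act_le hK.le hbd hc hJc hC hJb hJ0 q.1 q.2
      _ = _ := by ring
  have hswap : ∫ y, (∫ t in Ioi (0 : ℝ), currentForecast ω₂ lam β γ T N t y)
        ∂((pinnedChain ω₂ lam β γ).transitionKernel N T T τ.toNNReal x) =
      ∫ t in Ioi (0 : ℝ), ∫ y, currentForecast ω₂ lam β γ T N t y
        ∂((pinnedChain ω₂ lam β γ).transitionKernel N T T τ.toNNReal x) :=
    integral_integral_swap hint
  -- Step 2: Chapman–Kolmogorov on functions, `P_τ(P_tJ)(x) = P_{t+τ}J(x)` for `t ≥ 0`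
  have hck : ∀ t : ℝ, 0 ≤ t →
      ∫ y, currentForecast ω₂ lam β γ T N t y ∂((pinnedChain ω₂ lam β γ).transitionKernel N T T τ.toNNReal x) =
        currentForecast ω₂ lam β γ T N (t + τ) x := by
    intro t ht
    have hsum : (t + τ).toNNReal = τ.toNNReal + t.toNNReal := by
      rw [Real.toNNReal_add ht hτ, add_comm]
    have hJint : Integrable (fun y => ∑ i : Fin N, (pinnedChain ω₂ lam β γ).bondCurrent N i y)
        (((pinnedChain ω₂ lam β γ).transitionKernel N T T t.toNNReal ∘ₖ
          (pinnedChain ω₂ lam β γ).transitionKernel N T T τ.toNNReal) x) := by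
      rw [← pinnedChain_transitionKernel_add hω hl hβ.le hγ.le N T T]
      exact integrable_of_abs_le_exp
        (pinnedChain_integrable_exp_mul_hamiltonian_transitionKernel hω hl hT hβ.le hγ.le hN hϑ0 hϑ1 _ x) hJc hJb
    symm
    unfold currentForecast
    rw [hsum, pinnedChain_transitionKernel_add hω hl hβ.le hγ.le N T T, Kernel.integral_comp hJint]
  have hstep2 : ∫ t in Ioi (0 : ℝ), ∫ y, currentForecast ω₂ lam β γ T N t y
        ∂((pinnedChain ω₂ lam β γ).transitionKernel N T T τ.toNNReal x) =
      ∫ t in Ioi (0 : ℝ), currentForecast ω₂ lam β γ T N (t + τ) x :=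
    setIntegral_congr_fun measurableSet_Ioi fun t ht => hck t (le_of_lt ht)
  -- Step 3: translation `t ↦ t + τ`
  have htrans : ∫ t in Ioi (0 : ℝ), currentForecast ω₂ lam β γ T N (t + τ) x =
      ∫ s in Ioi τ, currentForecast ω₂ lam β γ T N s x := by
    have h := (measurePreserving_add_right volume τ).setIntegral_preimage_emb (measurableEmbedding_addRight τ)
      (fun s => currentForecast ω₂ lam β γ T N s x) (Ioi τ)
    simpa only [Set.preimage_add_const_Ioi, sub_self] using h
  -- Step 4: `(0, ∞) = (0, τ] ∪ (τ, ∞)` for the corrector at `x`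
  have hsplit : ∫ t in Ioi (0 : ℝ), currentForecast ω₂ lam β γ T N t x =
      (∫ t in Ioc (0 : ℝ) τ, currentForecast ω₂ lam β γ T N t x) +
        ∫ t in Ioi τ, currentForecast ω₂ lam β γ T N t x := by
    have hio : IntegrableOn (fun t : ℝ => currentForecast ω₂ lam β γ T N t x) (Ioi 0) :=
      centred_integrableOn_act hK.le hbd hc hJc hC hJb hJ0 hω hl hβ.le hγ.le x
    rw [← Set.Ioc_union_Ioi_eq_Ioi hτ, setIntegral_union (Set.Ioc_disjoint_Ioi_same) measurableSet_Ioi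
      (hio.mono_set Ioc_subset_Ioi_self) (hio.mono_set (Ioi_subset_Ioi hτ))]
  rw [hswap, hstep2, htrans, hsplit]
  ring

/-- **`‖u − u_τ‖_{L²(μ_T)} ≤ ‖u‖_{L²(μ_T)}` for every a.e.-limit corrector.** For every `N`, every `μ_T`-a.e. limit `u`
of the finite-horizon Kubo correctors of the total current (`μ_T = gibbsWeight`) and every `τ ≥ 0`:
`∫ (u − u_τ)² dμ_T ≤ ∫ u² dμ_T`. Proof: `u = u⋆` a.e. (uniqueness of limits), `u⋆ − u⋆_τ = P_τ u⋆` pointwise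
(`act_centredCorrector_eq`), and `P_τ` contracts `L²(μ_T)` on the strongly measurable, exponentially dominated `u⋆`.
(`N = 0`: `u_τ ≡ 0`.) [folklore] -/
theorem integral_sq_sub_horizonCorrector_le (hω : 0 < ω₂) (hl : 0 ≤ lam) (hβ : 0 < β) (hγ : 0 < γ) (hT : 0 < T)
    (N : ℕ) {u : PhaseSpace N → ℝ}
    (hu : ∀ᵐ x ∂(gibbsWeight ω₂ lam β γ T N),
      Tendsto (fun τ : ℝ => ∫ t in Ioc (0 : ℝ) τ, currentForecast ω₂ lam β γ T N t x) atTop (𝓝 (u x)))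
    {τ : ℝ} (hτ : 0 ≤ τ) :
    ∫ x, (u x - ∫ t in Ioc (0 : ℝ) τ, currentForecast ω₂ lam β γ T N t x) ^ 2 ∂(gibbsWeight ω₂ lam β γ T N) ≤
      ∫ x, (u x) ^ 2 ∂(gibbsWeight ω₂ lam β γ T N) := by
  rcases Nat.eq_zero_or_pos N with rfl | hN
  · have h0 : ∀ (t : ℝ) (x : PhaseSpace 0), currentForecast ω₂ lam β γ T 0 t x = 0 := by
      intro t x
      simp [currentForecast]
    simp only [h0, integral_zero, sub_zero, le_refl]
  -- Harris / Lyapunov constants at `ϑ = 1/(4T)`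
  obtain ⟨hϑ0, h2ϑ⟩ := quarter_inv_temp_admissible hT
  have hϑ1 : 1 / (4 * T) < 1 / T := by linarith
  obtain ⟨K, c, hK, hc, hbd⟩ := pinnedChain_harris_bound hω hl hβ hγ hN hT hϑ0 hϑ1
  have hJc := continuous_totalBondCurrent ω₂ lam β γ N
  have hJb := abs_totalBondCurrent_le_exp hω.le hl hβ.le γ N hϑ0
  have hJ0 := integral_totalBondCurrent_gibbsMeasure hω hl hβ.le γ N hT
  have hC : (0 : ℝ) ≤ N * (N * ((3 + β) / 2) * (2 * Real.exp (1 / (4 * T)) / (1 / (4 * T)) ^ 2)) := by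
    have := hβ.le
    positivity
  -- the canonical corrector
  set ustar : PhaseSpace N → ℝ := fun z => ∫ t in Ioi (0 : ℝ), currentForecast ω₂ lam β γ T N t z with hustar
  have hae : ∀ᵐ x ∂(gibbsWeight ω₂ lam β γ T N), u x = ustar x := by
    filter_upwards [hu] with x hx
    exact tendsto_nhds_unique hx (centred_tendsto_corrector hK.le hbd hc hJc hC hJb hJ0 hω hl hβ.le hγ.le x)
  have hdyn : ∀ x, ustar x - ∫ t in Ioc (0 : ℝ) τ, currentForecast ω₂ lam β γ T N t x =
      ∫ y, ustar y ∂((pinnedChain ω₂ lam β γ).transitionKernel N T T τ.toNNReal x) :=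
    fun x => (act_centredCorrector_eq hω hl hβ hγ hN hT hτ x).symm
  have hgm : StronglyMeasurable ustar :=
    pinnedChain_stronglyMeasurable_corrector hω hl hβ.le hγ.le T T hJc.measurable
  have hgb : ∀ y, |ustar y| ≤ K * (N * (N * ((3 + β) / 2) * (2 * Real.exp (1 / (4 * T)) / (1 / (4 * T)) ^ 2))) / c *
      Real.exp (1 / (4 * T) * (pinnedChain ω₂ lam β γ).hamiltonian N y) :=
    fun y => centred_abs_corrector_le hK.le hbd hc hJc hC hJb hJ0 y
  have key := (pinnedChain_integral_sq_act_le_of_stronglyMeasurable hω hl hβ hγ hN hT hϑ0 h2ϑ hgm hgb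
    τ.toNNReal).2.2
  calc ∫ x, (u x - ∫ t in Ioc (0 : ℝ) τ, currentForecast ω₂ lam β γ T N t x) ^ 2 ∂(gibbsWeight ω₂ lam β γ T N)
      = ∫ x, (ustar x - ∫ t in Ioc (0 : ℝ) τ, currentForecast ω₂ lam β γ T N t x) ^ 2
          ∂(gibbsWeight ω₂ lam β γ T N) :=
        integral_congr_ae (by filter_upwards [hae] with x hx; rw [hx])
    _ = ∫ x, (∫ y, ustar y ∂((pinnedChain ω₂ lam β γ).transitionKernel N T T τ.toNNReal x)) ^ 2
          ∂(gibbsWeight ω₂ lam β γ T N) := by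
        refine integral_congr_ae (Eventually.of_forall fun x => ?_)
        simp only [hdyn x]
    _ ≤ ∫ x, (ustar x) ^ 2 ∂(gibbsWeight ω₂ lam β γ T N) := by
        rw [gibbsWeight_eq_smul_gibbsMeasure hω hl hβ.le γ N hT, integral_smul_measure, integral_smul_measure]
        exact smul_le_smul_of_nonneg_left key ENNReal.toReal_nonneg
    _ = ∫ x, (u x) ^ 2 ∂(gibbsWeight ω₂ lam β γ T N) :=
        integral_congr_ae (by filter_upwards [hae] with x hx; rw [hx])

/-- **E1 ⟹ C2 (`PostCrossingForecast` is necessary for `ConeScaleCorrector`).** The cone-scale bound gives, with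
`a = 1` and the same constant, `u ∈ L²(μ_T)` and `∫ (u − u_{N})² dμ_T ≤ ∫ u² dμ_T ≤ C·N²·Z` for every a.e.-limit corrector
— the statement C2 VERBATIM as consumed by the landed D1 glue
`coneScaleCorrector_of_coneTransportBudget_of_postCrossingForecast`. [folklore] -/
theorem postCrossingForecast_of_coneScaleCorrector :
    Summit.AtomisticToContinuum.FouriersLaw.Theses.OddSectorIrreversibility.ConeScaleCorrector →
    (∀ ω₂ lam β γ : ℝ, 0 < ω₂ → 0 < lam → 0 < β → 0 < γ → ∀ T : ℝ, 0 < T → ∃ a C : ℝ, 0 < a ∧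
      ∀ (N : ℕ) (u : Literature.MathematicalPhysics.KineticTheory.HeatConduction.PhaseSpace N → ℝ),
      (∀ᵐ x ∂(Literature.MathematicalPhysics.KineticTheory.OddSectorLocality.gibbsWeight ω₂ lam β γ T N),
        Filter.Tendsto (fun τ : ℝ => ∫ t in Set.Ioc (0 : ℝ) τ,
          Literature.MathematicalPhysics.KineticTheory.OddSectorLocality.currentForecast ω₂ lam β γ T N t x)
          Filter.atTop (nhds (u x))) →
      MeasureTheory.MemLp u 2 (Literature.MathematicalPhysics.KineticTheory.OddSectorLocality.gibbsWeight ω₂ lam β γ T N) ∧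
      ∫ x, (u x - ∫ t in Set.Ioc (0 : ℝ) (a * (N : ℝ)),
          Literature.MathematicalPhysics.KineticTheory.OddSectorLocality.currentForecast ω₂ lam β γ T N t x) ^ 2
        ∂(Literature.MathematicalPhysics.KineticTheory.OddSectorLocality.gibbsWeight ω₂ lam β γ T N) ≤
      C * (N : ℝ) ^ 2 *
        ∫ x, Real.exp (-((Literature.MathematicalPhysics.KineticTheory.HeatConduction.pinnedChain ω₂ lam β γ).hamiltonian N x) / T)
          ∂MeasureTheory.volume) := by
  intro hE ω₂ lam β γ hω hl hβ hγ T hT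
  obtain ⟨C, hC⟩ := hE ω₂ lam β γ hω hl hβ hγ T hT
  refine ⟨1, C, one_pos, fun N u hu => ?_⟩
  have hEu := hC N u
  dsimp only at hEu
  obtain ⟨hmem, hbound⟩ := hEu hu
  refine ⟨hmem, ?_⟩
  change ∫ x, (u x) ^ 2 ∂(gibbsWeight ω₂ lam β γ T N) ≤ _ at hbound
  have h1N : (0 : ℝ) ≤ 1 * (N : ℝ) := by positivity
  exact (integral_sq_sub_horizonCorrector_le hω hl.le hβ hγ hT N hu h1N).trans hbound

end Summit.AtomisticToContinuum.FouriersLaw.Theorems.OddSectorIrreversibility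

end
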